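import Literature.MathematicalPhysics.QuantumFieldTheory.Balaban1983to89.B3ScalarPropagatorMean

/-!
# `Balaban1983to89.B3ScalarPropagatorCovariance` — T. Bałaban, *(Higgs)₂,₃ quantum fields in a finite volume. III.
Renormalization*, Commun. Math. Phys. **88** (1983) 411–445 [Balaban1983Higgs3], p. 414: **«The basic propagator for
the scalar field φ′ is G_k(Ω, B̃)»** AS A COVARIANCE STATEMENT, PROVED: for the Gaussian fluctuation `χ` of the old field
exhibited by the typer's `B3ScalarPropagatorMean.rt14_gaussian_eq` (weight `e^{−½⟨χ̃, G_k(Ω,B̃)^{−1}χ̃⟩}` on the fields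
`χ↾Ω`, `χ̃ = χ` extended by zero, `Ω = B^k(Ω^{(k)})`), the TWO-POINT FUNCTION is the propagator,
`∫ ⟨χ̃,g⟩⟨χ̃,f⟩ e^{−½⟨χ̃,G_k(Ω,B̃)^{−1}χ̃⟩} dχ = ⟨f, G_k(Ω,B̃)g⟩ · ∫ e^{−½⟨χ̃,G_k(Ω,B̃)^{−1}χ̃⟩} dχ` (`g` supported in `Ω`),
by Gaussian integration by parts on the fields on `Ω` (the Wick recursion for the `χ`-legs follows in the sequel
`B3ScalarPropagatorWick`); theorems only

statement-level skeleton of published theorems with citation tags; proofs where landed; nothing here is a claim about the Yang–Mills mass gap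

PDFs held: `paper:balaban1983-higgs-2-3-quantum-fields-finite-volume` (journal page = PDF page + 410),
`paper:balaban1982-cmp85-higgs23-i` (journal page = PDF page + 602); Glimm–Jaffe §9.1 (9.1.28) held as
`book:glimm1987-quantum-physics-functional-integral-point-view-2nd`.

CITATION HEADER (lean-in-tree rule).  lit-balaban typed skeleton (HOME `run/shared/lean/pub/lit-balaban/`), typer line,
sequel of `B3ScalarPropagatorMean` (the mean `φ′₀` and the Gaussian form of the fluctuation; this file: its covariance);
located member of the SKELETON rows **B3.Eq1.12-1.15** (p. 414 propagator paragraph) and **B3.Eq1.4** (owner r15; cells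
only, zero head weight).  THE SOURCE TEXT, p. 414 [PDF 4], verbatim: *"The basic propagator for the scalar field φ′ is
G_k(Ω, B̃), but there are other propagators also."*; p. 415 [PDF 5]: *"… a number of ways given expression can be
obtained from Gaussian integrals in (1.5)."*; paper I (2.20)/(2.22) p. 610: `G_k(Ω,A) = (−Δ^{η,N}_{A,Ω} + m²(L^kε)² +
a_kP_k(A))^{−1}`.

WHAT IS PROVED (0 sorry; theorems only; nothing re-declared — `covOpK` (= `G_k(Ω,B̃)^{−1}`), `propagatorK` (= `G_k(Ω,B̃)`),
`extendZero`, `region`, `siteInner` consumed BY NAME).  `C` a coupling, `B̃ = A` an external field on the `η`-lattice,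
`Ω^{(k)} ⊂ T^{(k)}`, `Ω = B^k(Ω^{(k)})`, `msq > 0` (↤ `m²(L^kε)²`), `a_k ≥ 0`.
* §1 `χ ↦ χ̃` is a continuous linear map (`extendZero_smul`, `exists_clm_extendZero`); `⟨χ̃,χ̃⟩ = η^d Σ_{x∈Ω}|χ(x)|²`
  (`siteInner_extendZero_self`); the legs `χ ↦ ⟨χ̃, f⟩` are continuous linear functionals (`exists_clm_extLeg`).
* §2 `hasFDerivAt_quadForm_ext`, **`hasFDerivAt_chiWeight`** — for a symmetric `M`, `∂_u e^{−½⟨χ̃,Mχ̃⟩} = −⟨χ̃, Mũ⟩ e^{−½⟨χ̃,Mχ̃⟩}`.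
* §3 `chiWeight_le` (coercivity (I.2.20): `e^{−½⟨χ̃,G_k^{−1}χ̃⟩} ≤ Π_{x∈Ω} e^{−(msq η^d/2)|χ(x)|²}`,
  `HiggsCovariancePos.siteInner_covOpK_ge`) and the exponential-growth integrability against the weight
  (`integrable_exp_mul_norm_mul_chiWeight`, `integrable_mul_chiWeight_of_abs_le`).
* §4 **`integral_leg_mul_eq_integral_deriv_chi`** — GAUSSIAN INTEGRATION BY PARTS on the fields on `Ω`:
  `∫ ⟨χ̃,g⟩ Φ(χ) e^{−½⟨χ̃,G_k^{−1}χ̃⟩} dχ = ∫ (∂_{(G_kg)↾Ω} Φ)(χ) e^{−½⟨χ̃,G_k^{−1}χ̃⟩} dχ` for `g` supported in `Ω`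
  (`G_kg` is supported in `Ω`, `B3ScalarPropagatorMean.propagatorK_apply_of_not_mem`, and `G_k^{−1}G_kg = g`).
* §5 **`integral_pair_chi`** (print's sentence: the two-point function of `χ` is `G_k(Ω,B̃)`) and the instance for the
  typed (1.4) (`data14_integral_pair_chi`: the `χ` of `rt14_gaussian_eq`, `B̃ = A^{(k)}`, `msq = m²(L^kε)²`).
HONEST SCOPE.  Unnormalised identities (both sides against the same weight; the normalisation `∫e^{−½⟨χ̃,G_k^{−1}χ̃⟩}dχ`, a
determinant, is not computed); `χ` lives on `Ω` and `G_k(Ω,B̃)` is the typer's operator restricted to `Ω`-supported fields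
(`B3ScalarPropagatorMean` §1).  Unit `lit-balaban-typer` gen 30 (literature-prover-lit-balaban-typer-g30-0); HOME/FILED.md
records the proposal.
-/

open scoped BigOperators InnerProductSpace
open _root_.MeasureTheory

namespace Literature.MathematicalPhysics.QuantumFieldTheory.Balaban1983to89.B3ScalarPropagatorCovariance

open Literature.MathematicalPhysics.QuantumFieldTheory.Balaban1983to89.HiggsLattice
open Literature.MathematicalPhysics.QuantumFieldTheory.Balaban1983to89.HiggsAveraging
open Literature.MathematicalPhysics.QuantumFieldTheory.Balaban1983to89.HiggsCovariance
open Literature.MathematicalPhysics.QuantumFieldTheory.Balaban1983to89.HiggsCovariancePos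
open Literature.MathematicalPhysics.QuantumFieldTheory.Balaban1983to89.HiggsFluctMeasure
open Literature.MathematicalPhysics.QuantumFieldTheory.Balaban1983to89.HiggsFluctMeasurePos
open Literature.MathematicalPhysics.QuantumFieldTheory.Balaban1983to89.B1Eq230FluctCovPos
open Literature.MathematicalPhysics.QuantumFieldTheory.Balaban1983to89.B3Eq14AuxFunction
open Literature.MathematicalPhysics.QuantumFieldTheory.Balaban1983to89.B3ScalarPropagatorMean

variable {P : HiggsLattice.Params} {N : ℕ}

/-! ## 1. `χ ↦ χ̃` (extension by zero) and the legs `⟨χ̃, f⟩` -/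

section Ext

variable (Ω : Finset (HiggsLattice.Site P 0))

/-- `extendZero` is homogeneous. [cite: Balaban1982Higgs1, (2.4) p.608] -/
theorem extendZero_smul (c : ℝ) (f : ↥Ω → EuclideanSpace ℝ (Fin N)) : extendZero Ω (c • f) = c • extendZero Ω f := by
  funext x
  by_cases hx : x ∈ Ω
  · simp [extendZero, hx]
  · simp [extendZero, hx]

/-- **`χ ↦ χ̃` is a continuous linear map** from the fields on `Ω` to the fields on `T_η`. [cite: Balaban1982Higgs1, (2.4) p.608] -/
theorem exists_clm_extendZero :
    ∃ T : (↥Ω → EuclideanSpace ℝ (Fin N)) →L[ℝ] ScalarField P 0 N, ∀ χ, T χ = extendZero Ω χ := by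
  let Tl : (↥Ω → EuclideanSpace ℝ (Fin N)) →ₗ[ℝ] ScalarField P 0 N :=
    { toFun := extendZero Ω
      map_add' := extendZero_add Ω
      map_smul' := fun c f => by rw [extendZero_smul, RingHom.id_apply] }
  exact ⟨LinearMap.toContinuousLinearMap Tl, fun χ => rfl⟩

/-- `⟨χ̃, χ̃⟩ = η^d Σ_{x∈Ω} |χ(x)|²` ((I.1.5) of a field extended by zero). [cite: Balaban1982Higgs1, (1.5) p.604] -/
theorem siteInner_extendZero_self (χ : ↥Ω → EuclideanSpace ℝ (Fin N)) :
    siteInner (extendZero Ω χ) (extendZero Ω χ) = ∑ x : ↥Ω, P.mesh 0 ^ P.d * ‖χ x‖ ^ 2 := by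
  rw [siteInner_self_eq]
  have h1 : ∑ x ∈ Ω, P.mesh 0 ^ P.d * ‖extendZero Ω χ x‖ ^ 2
      = ∑ x : HiggsLattice.Site P 0, P.mesh 0 ^ P.d * ‖extendZero Ω χ x‖ ^ 2 :=
    Finset.sum_subset (Finset.subset_univ Ω) fun x _ hx => by
      rw [extendZero_of_not_mem _ _ hx, norm_zero]
      ring
  rw [← h1, ← Finset.sum_coe_sort]
  exact Finset.sum_congr rfl fun x _ => by rw [extendZero_of_mem _ _ x.2]

/-- **The leg `χ ↦ ⟨χ̃, f⟩` is a continuous linear functional** on the fields on `Ω`. [cite: Balaban1982Higgs1, (1.5) p.604] -/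
theorem exists_clm_extLeg (f : ScalarField P 0 N) :
    ∃ ℓ : (↥Ω → EuclideanSpace ℝ (Fin N)) →L[ℝ] ℝ, ∀ χ, ℓ χ = siteInner (extendZero Ω χ) f := by
  let ℓ : (↥Ω → EuclideanSpace ℝ (Fin N)) →ₗ[ℝ] ℝ :=
    { toFun := fun χ => siteInner (extendZero Ω χ) f
      map_add' := fun χ ψ => by
        rw [extendZero_add, siteInner_comm, siteInner_add_right, siteInner_comm f, siteInner_comm f]
      map_smul' := fun c χ => by
        rw [extendZero_smul, siteInner_smul_left, RingHom.id_apply, smul_eq_mul] }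
  exact ⟨LinearMap.toContinuousLinearMap ℓ, fun χ => rfl⟩

/-- A leg is `≤ ‖ℓ‖e^{‖χ‖}` in absolute value. [cite: Balaban1982Higgs1, (1.5) p.604] -/
theorem abs_extLeg_le_of_clm {f : ScalarField P 0 N} {ℓ : (↥Ω → EuclideanSpace ℝ (Fin N)) →L[ℝ] ℝ}
    (hℓ : ∀ χ, ℓ χ = siteInner (extendZero Ω χ) f) (χ : ↥Ω → EuclideanSpace ℝ (Fin N)) :
    |siteInner (extendZero Ω χ) f| ≤ ‖ℓ‖ * Real.exp ‖χ‖ := by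
  rw [← hℓ χ, ← Real.norm_eq_abs]
  exact (ℓ.le_opNorm χ).trans (mul_le_mul_of_nonneg_left
    ((le_add_of_nonneg_right zero_le_one).trans (Real.add_one_le_exp _)) (norm_nonneg _))

end Ext

/-! ## 2. The derivative of the weight `e^{−½⟨χ̃, Mχ̃⟩}` -/

section Deriv

variable (Ω : Finset (HiggsLattice.Site P 0)) (M : ScalarField P 0 N →ₗ[ℝ] ScalarField P 0 N)

/-- **The quadratic form `χ ↦ ⟨χ̃, Mχ̃⟩` is differentiable with `∂_u⟨χ̃,Mχ̃⟩ = 2⟨χ̃, Mũ⟩`** for a symmetric `M`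
((I.1.5) is a finite sum of inner products; Leibniz). [cite: Balaban1982Higgs1, (2.20) p.610] -/
theorem hasFDerivAt_quadForm_ext (hM : ∀ f g : ScalarField P 0 N, siteInner f (M g) = siteInner g (M f))
    (χ : ↥Ω → EuclideanSpace ℝ (Fin N)) :
    ∃ D : (↥Ω → EuclideanSpace ℝ (Fin N)) →L[ℝ] ℝ,
      HasFDerivAt (fun ψ : ↥Ω → EuclideanSpace ℝ (Fin N) => siteInner (extendZero Ω ψ) (M (extendZero Ω ψ))) D χ ∧
      ∀ u, D u = 2 * siteInner (extendZero Ω χ) (M (extendZero Ω u)) := by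
  obtain ⟨T, hT⟩ := exists_clm_extendZero (P := P) (N := N) Ω
  set ML : ScalarField P 0 N →L[ℝ] ScalarField P 0 N := LinearMap.toContinuousLinearMap M with hML
  have hMLa : ∀ f, ML f = M f := fun f => rfl
  -- per site: the inner product of two continuous linear maps of `ψ`
  have hsite : ∀ x ∈ (Finset.univ : Finset (HiggsLattice.Site P 0)),
      HasFDerivAt (fun ψ : ↥Ω → EuclideanSpace ℝ (Fin N) => P.mesh 0 ^ P.d * ⟪(T ψ) x, (ML (T ψ)) x⟫_ℝ)
        ((P.mesh 0 ^ P.d) • ((fderivInnerCLM ℝ ((T χ) x, (ML (T χ)) x)).comp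
          (((ContinuousLinearMap.proj x).comp T).prod ((ContinuousLinearMap.proj x).comp (ML.comp T))))) χ := by
    intro x _
    have hf : HasFDerivAt (fun ψ : ↥Ω → EuclideanSpace ℝ (Fin N) => (T ψ) x)
        ((ContinuousLinearMap.proj x).comp T) χ := ((ContinuousLinearMap.proj x).comp T).hasFDerivAt
    have hg : HasFDerivAt (fun ψ : ↥Ω → EuclideanSpace ℝ (Fin N) => (ML (T ψ)) x)
        ((ContinuousLinearMap.proj x).comp (ML.comp T)) χ := ((ContinuousLinearMap.proj x).comp (ML.comp T)).hasFDerivAt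
    exact (hf.inner ℝ hg).const_mul (P.mesh 0 ^ P.d)
  have hsum := HasFDerivAt.fun_sum hsite
  have hfun : (fun ψ : ↥Ω → EuclideanSpace ℝ (Fin N) => siteInner (extendZero Ω ψ) (M (extendZero Ω ψ)))
      = fun ψ => ∑ x ∈ (Finset.univ : Finset (HiggsLattice.Site P 0)), P.mesh 0 ^ P.d * ⟪(T ψ) x, (ML (T ψ)) x⟫_ℝ := by
    funext ψ
    rw [← hT, ← hMLa]
    rfl
  refine ⟨∑ x ∈ (Finset.univ : Finset (HiggsLattice.Site P 0)), (P.mesh 0 ^ P.d) •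
      ((fderivInnerCLM ℝ ((T χ) x, (ML (T χ)) x)).comp
        (((ContinuousLinearMap.proj x).comp T).prod ((ContinuousLinearMap.proj x).comp (ML.comp T)))), ?_, fun u => ?_⟩
  · rw [hfun]
    exact hsum
  · simp only [_root_.sum_apply, _root_.smul_apply, smul_eq_mul, ContinuousLinearMap.comp_apply,
      ContinuousLinearMap.prod_apply, ContinuousLinearMap.proj_apply, fderivInnerCLM_apply, hT, hMLa]
    have h2 : ∑ x : HiggsLattice.Site P 0, P.mesh 0 ^ P.d *
        (⟪extendZero Ω χ x, M (extendZero Ω u) x⟫_ℝ + ⟪extendZero Ω u x, M (extendZero Ω χ) x⟫_ℝ)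
        = siteInner (extendZero Ω χ) (M (extendZero Ω u)) + siteInner (extendZero Ω u) (M (extendZero Ω χ)) := by
      unfold siteInner
      rw [← Finset.sum_add_distrib]
      exact Finset.sum_congr rfl fun x _ => by ring
    rw [h2, hM (extendZero Ω u) (extendZero Ω χ)]
    ring

/-- **`∂_u e^{−½⟨χ̃,Mχ̃⟩} = −⟨χ̃, Mũ⟩ e^{−½⟨χ̃,Mχ̃⟩}`** for a symmetric `M` (the pointwise identity behind Gaussian integration
by parts, Glimm–Jaffe (9.1.28)). [cite: Balaban1982Higgs1, (2.20) p.610] -/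
theorem hasFDerivAt_chiWeight (hM : ∀ f g : ScalarField P 0 N, siteInner f (M g) = siteInner g (M f))
    (χ : ↥Ω → EuclideanSpace ℝ (Fin N)) :
    ∃ D : (↥Ω → EuclideanSpace ℝ (Fin N)) →L[ℝ] ℝ,
      HasFDerivAt (fun ψ : ↥Ω → EuclideanSpace ℝ (Fin N) =>
        Real.exp (-(1 / 2 : ℝ) * siteInner (extendZero Ω ψ) (M (extendZero Ω ψ)))) D χ ∧
      ∀ u, D u = -siteInner (extendZero Ω χ) (M (extendZero Ω u))
        * Real.exp (-(1 / 2 : ℝ) * siteInner (extendZero Ω χ) (M (extendZero Ω χ))) := by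
  obtain ⟨D₀, hD₀, hD₀u⟩ := hasFDerivAt_quadForm_ext (P := P) (N := N) Ω M hM χ
  have h1 : HasFDerivAt (fun ψ : ↥Ω → EuclideanSpace ℝ (Fin N) =>
      -(1 / 2 : ℝ) * siteInner (extendZero Ω ψ) (M (extendZero Ω ψ))) ((-(1 / 2 : ℝ)) • D₀) χ :=
    hD₀.const_mul (-(1 / 2 : ℝ))
  have h2 := (Real.hasDerivAt_exp (-(1 / 2 : ℝ) * siteInner (extendZero Ω χ) (M (extendZero Ω χ)))).comp_hasFDerivAt χ h1
  refine ⟨_, h2, fun u => ?_⟩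
  simp only [_root_.smul_apply, smul_eq_mul, hD₀u]
  ring

end Deriv

/-! ## 3. Coercivity of `G_k(Ω,B̃)^{−1}` and integrability against the weight -/

section Integrability

variable (C : ChargeData N) (Ω : Finset (HiggsLattice.Site P 0)) (A : HiggsLattice.VecField P 0) {msq : ℝ} (a : ℝ) (k : ℕ)

/-- **Gaussian domination of the weight**: `e^{−½⟨χ̃, G_k(Ω,B̃)^{−1}χ̃⟩} ≤ Π_{x∈Ω} e^{−(msq·η^d/2)|χ(x)|²}` (coercivity
`⟨φ, G_k^{−1}φ⟩ ≥ msq⟨φ,φ⟩`, `HiggsCovariancePos.siteInner_covOpK_ge`; `a_k ≥ 0`). [cite: Balaban1982Higgs1, (2.20) p.610] -/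
theorem chiWeight_le (hak : 0 ≤ B1.aSeq a P.L k) (χ : ↥Ω → EuclideanSpace ℝ (Fin N)) :
    Real.exp (-(1 / 2 : ℝ) * siteInner (extendZero Ω χ) (covOpK C Ω A msq a k (extendZero Ω χ)))
      ≤ ∏ x : ↥Ω, Real.exp (-(msq * P.mesh 0 ^ P.d / 2) * ‖χ x‖ ^ 2) := by
  rw [← Real.exp_sum, Real.exp_le_exp]
  have h := siteInner_covOpK_ge C Ω A msq a k hak (extendZero Ω χ)
  rw [siteInner_extendZero_self] at h
  calc -(1 / 2 : ℝ) * siteInner (extendZero Ω χ) (covOpK C Ω A msq a k (extendZero Ω χ))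
      ≤ -(1 / 2 : ℝ) * (msq * ∑ x : ↥Ω, P.mesh 0 ^ P.d * ‖χ x‖ ^ 2) := by linarith
    _ = ∑ x : ↥Ω, -(msq * P.mesh 0 ^ P.d / 2) * ‖χ x‖ ^ 2 := by
        rw [Finset.mul_sum, Finset.mul_sum]
        exact Finset.sum_congr rfl fun x _ => by ring

/-- The Gaussian `e^{−c|v|²}`, `c > 0`, is integrable on `ℝ^N`. [folklore] -/
private theorem integrable_gaussian_euclidean {c : ℝ} (hc : 0 < c) :
    Integrable fun v : EuclideanSpace ℝ (Fin N) => Real.exp (-c * ‖v‖ ^ 2) := by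
  refine Integrable.of_integral_ne_zero ?_
  rw [GaussianFourier.integral_rexp_neg_mul_sq_norm hc]
  exact (Real.rpow_pos_of_pos (div_pos Real.pi_pos hc) _).ne'

/-- Completing the square in one variable: `ts − cs² ≤ t²/(2c) − (c/2)s²`. [folklore] -/
private theorem lin_sub_sq_le {c : ℝ} (hc : 0 < c) (t s : ℝ) :
    t * s + -c * s ^ 2 ≤ t ^ 2 / (2 * c) + -(c / 2) * s ^ 2 := by
  have h : 0 ≤ (t - c * s) ^ 2 / (2 * c) := by positivity
  have e : (t - c * s) ^ 2 / (2 * c) = t ^ 2 / (2 * c) - t * s + c / 2 * s ^ 2 := by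
    field_simp
    ring
  linarith

/-- `χ ↦ χ̃` is continuous. [cite: Balaban1982Higgs1, (2.4) p.608] -/
theorem continuous_extendZero : Continuous fun χ : ↥Ω → EuclideanSpace ℝ (Fin N) => extendZero Ω χ := by
  obtain ⟨T, hT⟩ := exists_clm_extendZero (P := P) (N := N) Ω
  have : (fun χ : ↥Ω → EuclideanSpace ℝ (Fin N) => extendZero Ω χ) = T := funext fun χ => (hT χ).symm
  rw [this]
  exact T.continuous

/-- The weight `e^{−½⟨χ̃,G_k(Ω,B̃)^{−1}χ̃⟩}` is continuous. [cite: Balaban1983Higgs3, (1.4) p.414] -/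
theorem continuous_chiWeight (msq : ℝ) : Continuous fun χ : ↥Ω → EuclideanSpace ℝ (Fin N) =>
    Real.exp (-(1 / 2 : ℝ) * siteInner (extendZero Ω χ) (covOpK C Ω A msq a k (extendZero Ω χ))) :=
  (continuous_const.mul (continuous_siteInner (continuous_extendZero Ω)
    ((LinearMap.toContinuousLinearMap (covOpK C Ω A msq a k)).continuous.comp (continuous_extendZero Ω)))).rexp

/-- **Exponential moments of the weight**: `χ ↦ e^{t‖χ‖} e^{−½⟨χ̃,G_k(Ω,B̃)^{−1}χ̃⟩}` is integrable on the fields on `Ω`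
(`msq > 0`, `a_k ≥ 0`; Gaussian domination site by site). [cite: Balaban1983Higgs3, (1.4) p.414] -/
theorem integrable_exp_mul_norm_mul_chiWeight (hmsq : 0 < msq) (hak : 0 ≤ B1.aSeq a P.L k) (t : ℝ) :
    Integrable fun χ : ↥Ω → EuclideanSpace ℝ (Fin N) =>
      Real.exp (t * ‖χ‖) * Real.exp (-(1 / 2 : ℝ) * siteInner (extendZero Ω χ) (covOpK C Ω A msq a k (extendZero Ω χ))) := by
  set c : ℝ := msq * P.mesh 0 ^ P.d / 2 with hc'
  have hc : 0 < c := by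
    have := P.mesh_pos 0
    positivity
  have hg : Integrable (fun χ : ↥Ω → EuclideanSpace ℝ (Fin N) =>
      ∏ x, (Real.exp (|t| ^ 2 / (2 * c)) * Real.exp (-(c / 2) * ‖χ x‖ ^ 2))) :=
    Integrable.fintype_prod (f := fun (_ : ↥Ω) (v : EuclideanSpace ℝ (Fin N)) =>
      Real.exp (|t| ^ 2 / (2 * c)) * Real.exp (-(c / 2) * ‖v‖ ^ 2))
      fun _ => (integrable_gaussian_euclidean (half_pos hc)).const_mul _
  refine hg.mono' ((continuous_const.mul continuous_norm).rexp.mul (continuous_chiWeight C Ω A a k msq)).aestronglyMeasurable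
    (Filter.Eventually.of_forall fun χ => ?_)
  rw [Real.norm_of_nonneg (mul_nonneg (Real.exp_pos _).le (Real.exp_pos _).le)]
  have hnorm : ‖χ‖ ≤ ∑ x : ↥Ω, ‖χ x‖ :=
    (pi_norm_le_iff_of_nonneg (Finset.sum_nonneg fun _ _ => norm_nonneg _)).2
      fun x => Finset.single_le_sum (fun y _ => norm_nonneg (χ y)) (Finset.mem_univ x)
  have h1 : t * ‖χ‖ ≤ |t| * ∑ x : ↥Ω, ‖χ x‖ :=
    (mul_le_mul_of_nonneg_right (le_abs_self t) (norm_nonneg _)).trans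
      (mul_le_mul_of_nonneg_left hnorm (abs_nonneg t))
  calc Real.exp (t * ‖χ‖) * Real.exp (-(1 / 2 : ℝ) * siteInner (extendZero Ω χ) (covOpK C Ω A msq a k (extendZero Ω χ)))
      ≤ Real.exp (|t| * ∑ x : ↥Ω, ‖χ x‖) * ∏ x : ↥Ω, Real.exp (-c * ‖χ x‖ ^ 2) :=
        mul_le_mul (Real.exp_le_exp.2 h1) (chiWeight_le C Ω A a k hak χ) (Real.exp_pos _).le (Real.exp_pos _).le
    _ = ∏ x : ↥Ω, Real.exp (|t| * ‖χ x‖ + -c * ‖χ x‖ ^ 2) := by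
        rw [Finset.mul_sum, Real.exp_sum, ← Finset.prod_mul_distrib]
        exact Finset.prod_congr rfl fun x _ => by rw [Real.exp_add]
    _ ≤ ∏ x : ↥Ω, (Real.exp (|t| ^ 2 / (2 * c)) * Real.exp (-(c / 2) * ‖χ x‖ ^ 2)) :=
        Finset.prod_le_prod (fun _ _ => (Real.exp_pos _).le) fun x _ => by
          rw [← Real.exp_add]
          exact Real.exp_le_exp.2 (lin_sub_sq_le hc |t| ‖χ x‖)

/-- A continuous function of exponential growth is integrable against the weight. [cite: Balaban1983Higgs3, (1.4) p.414] -/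
theorem integrable_mul_chiWeight_of_abs_le (hmsq : 0 < msq) (hak : 0 ≤ B1.aSeq a P.L k)
    {Ψ : (↥Ω → EuclideanSpace ℝ (Fin N)) → ℝ} (hΨ : Continuous Ψ) {K t : ℝ} (hb : ∀ χ, |Ψ χ| ≤ K * Real.exp (t * ‖χ‖)) :
    Integrable fun χ : ↥Ω → EuclideanSpace ℝ (Fin N) =>
      Ψ χ * Real.exp (-(1 / 2 : ℝ) * siteInner (extendZero Ω χ) (covOpK C Ω A msq a k (extendZero Ω χ))) := by
  refine ((integrable_exp_mul_norm_mul_chiWeight C Ω A a k hmsq hak t).const_mul K).mono'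
    (hΨ.mul (continuous_chiWeight C Ω A a k msq)).aestronglyMeasurable (Filter.Eventually.of_forall fun χ => ?_)
  rw [Real.norm_eq_abs, abs_mul, abs_of_pos (Real.exp_pos _), ← mul_assoc]
  exact mul_le_mul_of_nonneg_right (hb χ) (Real.exp_pos _).le

end Integrability

/-! ## 4. Gaussian integration by parts on the fields on `Ω = B^k(Ω^{(k)})` -/

section IBP

variable (C : ChargeData N) (A : HiggsLattice.VecField P 0) {k : ℕ} (Ωk : Finset (HiggsLattice.Site P k)) {msq : ℝ} (a : ℝ)

/-- Whole-space integration by parts on the fields on `Ω` (no boundary terms): if `∂_u ρ = −ℓρ` then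
`∫ ℓ G ρ = ∫ (∂_u G) ρ` once the three products are integrable (abstract Glimm–Jaffe (9.1.28)). [cite: Balaban1983Higgs3, (1.4) p.414] -/
theorem integral_mul_mul_eq_integral_fderiv_mul_chi {Ω : Finset (HiggsLattice.Site P 0)}
    {ρ ℓ G : (↥Ω → EuclideanSpace ℝ (Fin N)) → ℝ} {u : ↥Ω → EuclideanSpace ℝ (Fin N)}
    (hρd : Differentiable ℝ ρ) (hρ' : ∀ v, fderiv ℝ ρ v u = -(ℓ v * ρ v)) (hG : ∀ v, DifferentiableAt ℝ G v)
    (h1 : Integrable fun v => ℓ v * G v * ρ v) (h2 : Integrable fun v => fderiv ℝ G v u * ρ v)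
    (h3 : Integrable fun v => G v * ρ v) :
    ∫ v, ℓ v * G v * ρ v = ∫ v, fderiv ℝ G v u * ρ v := by
  have hB : Integrable fun v => G v * fderiv ℝ ρ v u := by
    have : (fun v => G v * fderiv ℝ ρ v u) = fun v => -(ℓ v * G v * ρ v) := by
      funext v
      rw [hρ' v]
      ring
    rw [this]
    exact h1.neg
  have hibp := integral_mul_fderiv_eq_neg_fderiv_mul_of_integrable h2 hB h3 (fun v _ => hG v)
    (fun v _ => hρd v)
  calc ∫ v, ℓ v * G v * ρ v = ∫ v, -(G v * fderiv ℝ ρ v u) := by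
        congr 1
        funext v
        rw [hρ' v]
        ring
    _ = -∫ v, G v * fderiv ℝ ρ v u := integral_neg _
    _ = ∫ v, fderiv ℝ G v u * ρ v := by rw [hibp, neg_neg]

/-- **GAUSSIAN INTEGRATION BY PARTS on the fields on `Ω = B^k(Ω^{(k)})`** for the weight `e^{−½⟨χ̃,G_k(Ω,B̃)^{−1}χ̃⟩}`:
for `g` supported in `Ω` and differentiable `Φ` with `Φ`, `∂_{(G_kg)↾Ω}Φ` continuous of exponential growth,
`∫ ⟨χ̃, g⟩ Φ(χ) e^{−½⟨χ̃,G_k^{−1}χ̃⟩} dχ = ∫ (∂_{(G_kg)↾Ω}Φ)(χ) e^{−½⟨χ̃,G_k^{−1}χ̃⟩} dχ` — `G_k(Ω,B̃)g` is supported in `Ω`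
and `G_k^{−1}G_kg = g`; `msq > 0`, `a_k ≥ 0`. PROVED. [cite: Balaban1983Higgs3, (1.4) p.414] -/
theorem integral_leg_mul_eq_integral_deriv_chi (hmsq : 0 < msq) (hak : 0 ≤ B1.aSeq a P.L k)
    {g : ScalarField P 0 N} (hg : ∀ x, x ∉ region k Ωk → g x = 0)
    {Φ : (↥(region k Ωk) → EuclideanSpace ℝ (Fin N)) → ℝ}
    {Φ' : (↥(region k Ωk) → EuclideanSpace ℝ (Fin N)) → (↥(region k Ωk) → EuclideanSpace ℝ (Fin N)) →L[ℝ] ℝ}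
    (hΦ : ∀ χ, HasFDerivAt Φ (Φ' χ) χ)
    (hΦ'c : Continuous fun χ => Φ' χ (fun x => propagatorK C (region k Ωk) A msq a k g x.1))
    {K t : ℝ} (hΦb : ∀ χ, |Φ χ| ≤ K * Real.exp (t * ‖χ‖))
    (hΦ'b : ∀ χ, |Φ' χ (fun x => propagatorK C (region k Ωk) A msq a k g x.1)| ≤ K * Real.exp (t * ‖χ‖)) :
    ∫ χ, siteInner (extendZero (region k Ωk) χ) g * Φ χ
        * Real.exp (-(1 / 2 : ℝ) * siteInner (extendZero (region k Ωk) χ)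
            (covOpK C (region k Ωk) A msq a k (extendZero (region k Ωk) χ)))
      = ∫ χ, Φ' χ (fun x => propagatorK C (region k Ωk) A msq a k g x.1)
        * Real.exp (-(1 / 2 : ℝ) * siteInner (extendZero (region k Ωk) χ)
            (covOpK C (region k Ωk) A msq a k (extendZero (region k Ωk) χ))) := by
  set u : ↥(region k Ωk) → EuclideanSpace ℝ (Fin N) := fun x => propagatorK C (region k Ωk) A msq a k g x.1 with hu
  have hΦc : Continuous Φ := continuous_iff_continuousAt.2 fun χ => (hΦ χ).continuousAt
  have hΦd : ∀ χ, DifferentiableAt ℝ Φ χ := fun χ => (hΦ χ).differentiableAt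
  have hfd : ∀ χ, fderiv ℝ Φ χ u = Φ' χ u := fun χ => by rw [(hΦ χ).fderiv]
  obtain ⟨ℓ, hℓ⟩ := exists_clm_extLeg (P := P) (N := N) (region k Ωk) g
  have hℓc : Continuous fun χ : ↥(region k Ωk) → EuclideanSpace ℝ (Fin N) => siteInner (extendZero (region k Ωk) χ) g := by
    have : (fun χ : ↥(region k Ωk) → EuclideanSpace ℝ (Fin N) => siteInner (extendZero (region k Ωk) χ) g) = ℓ :=
      funext fun χ => (hℓ χ).symm
    rw [this]
    exact ℓ.continuous
  have hK : 0 ≤ K := (abs_nonneg _).trans (by simpa using hΦb 0)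
  -- `ũ = G_kg` (supported in `Ω`) and `G_k^{-1}G_kg = g`
  have hext : extendZero (region k Ωk) u = propagatorK C (region k Ωk) A msq a k g := by
    funext x
    by_cases hx : x ∈ region k Ωk
    · rw [extendZero_of_mem _ _ hx]
    · rw [extendZero_of_not_mem _ _ hx, propagatorK_apply_of_not_mem C A Ωk msq a hmsq hak hg hx]
  have hsym := siteInner_covOpK_comm C (region k Ωk) A msq a k
  have hρ' : ∀ χ : ↥(region k Ωk) → EuclideanSpace ℝ (Fin N),
      fderiv ℝ (fun ψ : ↥(region k Ωk) → EuclideanSpace ℝ (Fin N) =>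
        Real.exp (-(1 / 2 : ℝ) * siteInner (extendZero (region k Ωk) ψ)
          (covOpK C (region k Ωk) A msq a k (extendZero (region k Ωk) ψ)))) χ u
        = -(siteInner (extendZero (region k Ωk) χ) g * Real.exp (-(1 / 2 : ℝ) * siteInner (extendZero (region k Ωk) χ)
          (covOpK C (region k Ωk) A msq a k (extendZero (region k Ωk) χ)))) := fun χ => by
    obtain ⟨D, hD, hDu⟩ := hasFDerivAt_chiWeight (P := P) (N := N) (region k Ωk) (covOpK C (region k Ωk) A msq a k) hsym χ
    rw [hD.fderiv, hDu, hext, covOpK_propagatorK_apply C _ A hmsq a k hak, neg_mul]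
  have hρd : Differentiable ℝ (fun ψ : ↥(region k Ωk) → EuclideanSpace ℝ (Fin N) =>
      Real.exp (-(1 / 2 : ℝ) * siteInner (extendZero (region k Ωk) ψ)
        (covOpK C (region k Ωk) A msq a k (extendZero (region k Ωk) ψ)))) := fun χ => by
    obtain ⟨D, hD, -⟩ := hasFDerivAt_chiWeight (P := P) (N := N) (region k Ωk) (covOpK C (region k Ωk) A msq a k) hsym χ
    exact hD.differentiableAt
  have i1 : Integrable fun χ : ↥(region k Ωk) → EuclideanSpace ℝ (Fin N) =>
      siteInner (extendZero (region k Ωk) χ) g * Φ χ * Real.exp (-(1 / 2 : ℝ) * siteInner (extendZero (region k Ωk) χ)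
        (covOpK C (region k Ωk) A msq a k (extendZero (region k Ωk) χ))) := by
    refine integrable_mul_chiWeight_of_abs_le C (region k Ωk) A a k hmsq hak (hℓc.mul hΦc) (K := ‖ℓ‖ * K) (t := 1 + t)
      fun χ => ?_
    rw [abs_mul, add_mul, one_mul, Real.exp_add]
    calc |siteInner (extendZero (region k Ωk) χ) g| * |Φ χ| ≤ (‖ℓ‖ * Real.exp ‖χ‖) * (K * Real.exp (t * ‖χ‖)) :=
          mul_le_mul (abs_extLeg_le_of_clm (region k Ωk) hℓ χ) (hΦb χ) (abs_nonneg _) (by positivity)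
      _ = ‖ℓ‖ * K * (Real.exp ‖χ‖ * Real.exp (t * ‖χ‖)) := by ring
  have i2 : Integrable fun χ : ↥(region k Ωk) → EuclideanSpace ℝ (Fin N) =>
      fderiv ℝ Φ χ u * Real.exp (-(1 / 2 : ℝ) * siteInner (extendZero (region k Ωk) χ)
        (covOpK C (region k Ωk) A msq a k (extendZero (region k Ωk) χ))) := by
    simp_rw [hfd]
    exact integrable_mul_chiWeight_of_abs_le C (region k Ωk) A a k hmsq hak hΦ'c hΦ'b
  have i3 : Integrable fun χ : ↥(region k Ωk) → EuclideanSpace ℝ (Fin N) =>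
      Φ χ * Real.exp (-(1 / 2 : ℝ) * siteInner (extendZero (region k Ωk) χ)
        (covOpK C (region k Ωk) A msq a k (extendZero (region k Ωk) χ))) :=
    integrable_mul_chiWeight_of_abs_le C (region k Ωk) A a k hmsq hak hΦc hΦb
  have key := integral_mul_mul_eq_integral_fderiv_mul_chi hρd hρ' hΦd i1 i2 i3
  simp_rw [hfd] at key
  exact key

end IBP

/-! ## 5. «The basic propagator for the scalar field φ′ is G_k(Ω, B̃)»: the two-point function -/

section Covariance

variable (C : ChargeData N) (A : HiggsLattice.VecField P 0) {k : ℕ} (Ωk : Finset (HiggsLattice.Site P k)) {msq : ℝ} (a : ℝ)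

/-- **THE TWO-POINT FUNCTION OF THE FLUCTUATION `χ` IS THE PROPAGATOR `G_k(Ω,B̃)`** — print's *"The basic propagator
for the scalar field φ′ is G_k(Ω, B̃)"* (p. 414) for the `χ` of `B3ScalarPropagatorMean.rt14_gaussian_eq`:
`∫ ⟨χ̃,g⟩⟨χ̃,f⟩ e^{−½⟨χ̃,G_k(Ω,B̃)^{−1}χ̃⟩} dχ = ⟨f, G_k(Ω,B̃)g⟩ · ∫ e^{−½⟨χ̃,G_k(Ω,B̃)^{−1}χ̃⟩} dχ` for every `f` and every
`g` supported in `Ω`; `msq > 0`, `a_k ≥ 0`. PROVED (integration by parts; the derivative of a leg is constant).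
[cite: Balaban1983Higgs3, (1.4) p.414] -/
theorem integral_pair_chi (hmsq : 0 < msq) (hak : 0 ≤ B1.aSeq a P.L k) (f : ScalarField P 0 N)
    {g : ScalarField P 0 N} (hg : ∀ x, x ∉ region k Ωk → g x = 0) :
    ∫ χ, siteInner (extendZero (region k Ωk) χ) g * siteInner (extendZero (region k Ωk) χ) f
        * Real.exp (-(1 / 2 : ℝ) * siteInner (extendZero (region k Ωk) χ)
            (covOpK C (region k Ωk) A msq a k (extendZero (region k Ωk) χ)))
      = siteInner f (propagatorK C (region k Ωk) A msq a k g)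
        * ∫ χ, Real.exp (-(1 / 2 : ℝ) * siteInner (extendZero (region k Ωk) χ)
            (covOpK C (region k Ωk) A msq a k (extendZero (region k Ωk) χ))) := by
  obtain ⟨ℓ, hℓ⟩ := exists_clm_extLeg (P := P) (N := N) (region k Ωk) f
  have hΦ : ∀ χ, HasFDerivAt (fun ψ : ↥(region k Ωk) → EuclideanSpace ℝ (Fin N) => siteInner (extendZero (region k Ωk) ψ) f) ℓ χ := by
    intro χ
    have : (fun ψ : ↥(region k Ωk) → EuclideanSpace ℝ (Fin N) => siteInner (extendZero (region k Ωk) ψ) f) = ℓ :=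
      funext fun ψ => (hℓ ψ).symm
    rw [this]
    exact ℓ.hasFDerivAt
  have hext : extendZero (region k Ωk) (fun x : ↥(region k Ωk) => propagatorK C (region k Ωk) A msq a k g x.1)
      = propagatorK C (region k Ωk) A msq a k g := by
    funext x
    by_cases hx : x ∈ region k Ωk
    · rw [extendZero_of_mem _ _ hx]
    · rw [extendZero_of_not_mem _ _ hx, propagatorK_apply_of_not_mem C A Ωk msq a hmsq hak hg hx]
  have hconst : ℓ (fun x : ↥(region k Ωk) => propagatorK C (region k Ωk) A msq a k g x.1)
      = siteInner f (propagatorK C (region k Ωk) A msq a k g) := by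
    rw [hℓ, hext, siteInner_comm]
  have hK : ∀ χ : ↥(region k Ωk) → EuclideanSpace ℝ (Fin N), |siteInner (extendZero (region k Ωk) χ) f|
      ≤ max ‖ℓ‖ |siteInner f (propagatorK C (region k Ωk) A msq a k g)| * Real.exp (1 * ‖χ‖) := fun χ => by
    rw [one_mul]
    exact (abs_extLeg_le_of_clm (region k Ωk) hℓ χ).trans (mul_le_mul_of_nonneg_right (le_max_left _ _) (Real.exp_pos _).le)
  have hK' : ∀ χ : ↥(region k Ωk) → EuclideanSpace ℝ (Fin N),
      |ℓ (fun x : ↥(region k Ωk) => propagatorK C (region k Ωk) A msq a k g x.1)|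
        ≤ max ‖ℓ‖ |siteInner f (propagatorK C (region k Ωk) A msq a k g)| * Real.exp (1 * ‖χ‖) := fun χ => by
    rw [hconst, one_mul]
    exact (le_max_right _ _).trans (le_mul_of_one_le_right (le_max_of_le_left (norm_nonneg _)) (Real.one_le_exp (norm_nonneg _)))
  rw [integral_leg_mul_eq_integral_deriv_chi C A Ωk a hmsq hak hg hΦ continuous_const hK hK']
  simp_rw [hconst]
  exact integral_const_mul _ _

end Covariance

/-! ## 6. For the typed (1.4): the `χ` of `rt14_gaussian_eq` has two-point function `G_k(Ω, A^{(k)})` -/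

section Typed

variable {k : ℕ} (D : Data14 P N k)

/-- **«The basic propagator for the scalar field φ′ is G_k(Ω, B̃)» FOR THE TYPED (1.4)**: the Gaussian fluctuation `χ↾Ω`
of `B3ScalarPropagatorMean.rt14_gaussian_eq` (`B̃ = A^{(k)}`, `msq = m²(L^kε)² > 0`, `a_k ≥ 0`) has the two-point function
`G_k(Ω, A^{(k)})`: `∫ ⟨χ̃,g⟩⟨χ̃,f⟩ e^{−½⟨χ̃,G_k(Ω,A^{(k)})^{−1}χ̃⟩} dχ = ⟨f, G_k(Ω,A^{(k)})g⟩ · ∫ e^{−½⟨χ̃,G_k(Ω,A^{(k)})^{−1}χ̃⟩} dχ`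
(`g` supported in `Ω`). [cite: Balaban1983Higgs3, (1.4) p.414] -/
theorem data14_integral_pair_chi (hm : 0 < D.m2 * D.ell ^ 2) (hak : 0 ≤ B1.aSeq D.a P.L k) (Ak : HiggsLattice.VecField P 0)
    (f : ScalarField P 0 N) {g : ScalarField P 0 N} (hg : ∀ x, x ∉ D.Ω → g x = 0) :
    ∫ χ : ↥D.Ω → EuclideanSpace ℝ (Fin N), siteInner (extendZero D.Ω χ) g * siteInner (extendZero D.Ω χ) f
        * Real.exp (-(1 / 2 : ℝ) * siteInner (extendZero D.Ω χ) (covOpK D.C D.Ω Ak (D.m2 * D.ell ^ 2) D.a k (extendZero D.Ω χ)))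
      = siteInner f (propagatorK D.C D.Ω Ak (D.m2 * D.ell ^ 2) D.a k g)
        * ∫ χ : ↥D.Ω → EuclideanSpace ℝ (Fin N),
            Real.exp (-(1 / 2 : ℝ) * siteInner (extendZero D.Ω χ) (covOpK D.C D.Ω Ak (D.m2 * D.ell ^ 2) D.a k (extendZero D.Ω χ))) :=
  integral_pair_chi D.C Ak D.Ωk D.a hm hak f hg

end Typed

end Literature.MathematicalPhysics.QuantumFieldTheory.Balaban1983to89.B3ScalarPropagatorCovariance
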